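import Summits.CriticalPhenomena.PercolationContinuityZ3.Theorems.PercNearOneGluingNoHeavyQuantIndepBlobGradedMerge
import Summits.CriticalPhenomena.PercolationContinuityZ3.Theorems.PercNearOneGluingNoHeavyQuantDIBStar
import HarnessLib

/-!
# QUANT lane R8, FAR on general trees: the MERGE CERTIFICATE for a term of the root reduction
# (rule μ next to α/β/γ/ε of `…QuantDIBStar`: light blobs that merge upward count at full credit)

builds on p205010 (kernel theorem, internal audit signed; external expert review pending)

Support file (`--supports stmt-CriticalPhenomena-4575`), QUANT lane seat prim-quant-p1 (gen 11); memo
`run/shared/lean/prim/quant/P1-SURPLUS.md` §22.  Theorems only; no definitions, no sorries, standard axioms.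

In the architecture of record for `Quant.FarTreeRow` (census-2 g49 ARCH-TREES-G49, README V185; kernel frame = typer g17's
`…QuantRootReduction` / `…QuantDIBStar`) the root tail is a mixture of TERMS `TERM[s, a, g, j] = P(s + Σ_{k open} a k ≥ j+1)` (sure mass `s`
plus independent blobs), and a term is certified at floor `x` by β (sure), α (a heavy giant), γ (DIB\*, conjectural for `x > 1/2`) or ε
(Cantelli).  This file adds the unconditional rule

* μ (`RootDec.term_ge_of_gradedMerge`): gates in `[0,1]`, `x ≤ 1`; every blob below the floor (`g k < x`) satisfies
  `j ≤ s + g k · Σ_{i : g k < g i} a i` with some strictly more reliable blob of positive size; and `2j < 2s + Σ_k a k · g k` (FULL credit for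
  every blob) ⟹ `x ≤ TERM[s, a, g, j]` — the graded merge row `IndepBlob.tail_ge_of_gradedMerge'` (`…QuantIndepBlobGradedMerge`, p1 g11) at
  layer `j − s`;
* `RootDec.term_ge_of_mergeable_light` — the same with targets = the heavy blobs only (`j ≤ s + g k · A_H`).

[cite: KozmaNitzan2024, Conjecture 3 (p. 15)] (the gluing rows served); the rule is [this work].
-/

namespace Summit.CriticalPhenomena.PercolationContinuityZ3.Theorems

namespace Quant

namespace RootDec

open Finset

variable {κ : Type} [Fintype κ] [DecidableEq κ]

/-- product-Bernoulli weight of the set `W` of open blobs (as in `…QuantRootReduction`) -/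
local notation3 "wt[" g ", " W "]" => ∏ k, (if k ∈ (W : Finset κ) then (g : κ → ℝ) k else 1 - (g : κ → ℝ) k)

/-- the TERM tail `P(s + Σ_{k open} a k ≥ j+1)` (as in `…QuantRootReduction`) -/
local notation3 "TERM[" s ", " a ", " g ", " j "]" =>
  ∑ W : Finset κ, wt[g, W] * (if (j : ℕ) + 1 ≤ (s : ℕ) + ∑ k ∈ W, (a : κ → ℕ) k then (1 : ℝ) else 0)

/-- **μ — the merge certificate of a term.**  Gates in `[0,1]`, floor `x ≤ 1`, sure mass `s`, layer `j`.  If every blob below the floor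
(`g k < x`) is mergeable at layer `j − s` — `j ≤ s + g k · Σ_{i : g k < g i} a i` and some strictly more reliable blob has positive size —
and `2j < 2s + Σ_k a k · g k` (every blob at FULL credit), then `x ≤ TERM[s, a, g, j]`. [this work] -/
theorem term_ge_of_gradedMerge (s : ℕ) (a : κ → ℕ) (g : κ → ℝ) (j : ℕ) (x : ℝ) (hx1 : x ≤ 1)
    (hg : ∀ k, 0 ≤ g k ∧ g k ≤ 1)
    (hM : ∀ k, g k < x → (j : ℝ) ≤ s + g k * ∑ i ∈ (Finset.univ : Finset κ).filter (fun i => g k < g i), (a i : ℝ))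
    (hM0 : ∀ k, g k < x → ∃ i, g k < g i ∧ 0 < a i)
    (hbudget : (2 * j : ℝ) < 2 * s + ∑ k, (a k : ℝ) * g k) : x ≤ TERM[s, a, g, j] := by
  by_cases hs : j + 1 ≤ s
  · rw [term_eq_one_of_sure s a g j hs]; exact hx1
  have hsj : s ≤ j := by omega
  rw [term_shift s a g j hsj]
  refine IndepBlob.tail_ge_of_gradedMerge' g a x (j - s) (fun k => (hg k).1) (fun k => (hg k).2) hx1 (fun k hk => ?_) hM0 ?_
  · have := hM k hk
    rw [Nat.cast_sub hsj]
    linarith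
  · rw [Nat.cast_sub hsj]
    linarith

/-- **μ with heavy targets only.**  As `term_ge_of_gradedMerge`, with the merge condition against the HEAVY mass: every blob below the floor
has `j ≤ s + g k · Σ_{i : x ≤ g i} a i`, and some heavy blob has positive size. [this work] -/
theorem term_ge_of_mergeable_light (s : ℕ) (a : κ → ℕ) (g : κ → ℝ) (j : ℕ) (x : ℝ) (hx1 : x ≤ 1)
    (hg : ∀ k, 0 ≤ g k ∧ g k ≤ 1) (hH : ∃ i, x ≤ g i ∧ 0 < a i)
    (hM : ∀ k, g k < x → (j : ℝ) ≤ s + g k * ∑ i ∈ (Finset.univ : Finset κ).filter (fun i => x ≤ g i), (a i : ℝ))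
    (hbudget : (2 * j : ℝ) < 2 * s + ∑ k, (a k : ℝ) * g k) : x ≤ TERM[s, a, g, j] := by
  refine term_ge_of_gradedMerge s a g j x hx1 hg (fun k hk => (hM k hk).trans ?_) (fun k hk => ?_) hbudget
  · have hsub : ∑ i ∈ (Finset.univ : Finset κ).filter (fun i => x ≤ g i), (a i : ℝ) ≤
        ∑ i ∈ (Finset.univ : Finset κ).filter (fun i => g k < g i), (a i : ℝ) := by
      refine Finset.sum_le_sum_of_subset_of_nonneg (fun i hi => ?_) fun i _ _ => Nat.cast_nonneg _
      rw [Finset.mem_filter] at hi ⊢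
      exact ⟨hi.1, lt_of_lt_of_le hk hi.2⟩
    have := mul_le_mul_of_nonneg_left hsub (hg k).1
    linarith
  · obtain ⟨i, hi, hai⟩ := hH
    exact ⟨i, lt_of_lt_of_le hk hi, hai⟩

end RootDec

end Quant

end Summit.CriticalPhenomena.PercolationContinuityZ3.Theorems
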